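import Mathlib.Topology.Instances.ZMod
import Mathlib.Algebra.Group.Units.Equiv
import Literature.AnabelianGeometry.AbsoluteAnabelian.GaloisSectionsFacts
import HarnessLib

/-!
# [GalSect] Thm 4.3: `GalSect.Thm_4_3 T sx sy` (FACT-LIST F-0105) is a SCHEMA over free synchronization data —
# universal closure refuted, the rigidity it expresses made explicit, instance forms recorded

S. Mochizuki, *Galois sections in absolute anabelian geometry*, Nagoya Math. J. 179 (2005) 17–45
[MochizukiGalSect2005], Thm 4.3 p. 17 (kurims manuscript pagination, lit key `paper:url-1b7afe4e6889`),
"Rigidity of Cuspidal Geometric Decomposition Groups": "suppose that `α` induces isomorphisms `I_x ⥲ I_y`;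
`μ^∧_{ℚ/ℤ}(K̄) ⥲ μ^∧_{ℚ/ℤ}(L̄)` … Then these isomorphisms are compatible with the natural isomorphisms
`μ^∧_{ℚ/ℤ}(K̄) ⥲ I_x`; `μ^∧_{ℚ/ℤ}(L̄) ⥲ I_y`."

PROOF-ONLY companion of `GaloisSectionsFacts.lean`, abc-iut cell seat abc-iut-f-097 (block F, tranche 97).
The trunk file types Thm 4.3 (policy θ, shape (1)) as a PREDICATE `Thm_4_3 T sx sy` on: an ARBITRARY
"Galois cyclotome" interface `T : GalSect.GaloisCyclotome` (any functor-like assignment `G ↦ μ(G)`), and ARBITRARY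
"synchronizations" `sx : μ(G_K) ≃* I_x`, `sy : μ(G_L) ≃* I_y` (the structure `CuspidalSynchronization` carries the
bare isomorphism, not its construction from roots of local coordinates).  FACT-LIST row **F-0105** (`fact-open`,
class preparatory, kernel_closedness `parametrised`) is therefore a schema (R5).  The kernel objects:

* `GalSect.CuspidalSynchronization.natIso_eq_of_thm_4_3` — THE CONTENT of the predicate in the self-case
  (`Y_L = X_K`, `y = x`, `α = id`): `Thm_4_3 T sx sy` forces `sy = sx`.  So the predicate PINS the synchronization;
  it is a genuine hypothesis on `(sx, sy)` (in print: both are THE natural isomorphisms), not a property of the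
  group data;
* `GalSect.not_thm_4_3_inv_twist` — consequently, twisting a synchronization by inversion `m ↦ m⁻¹` of the
  cyclotome violates the predicate as soon as the cyclotome has an element with `m² ≠ 1`;
* `GalSect.not_forall_thm_4_3` — **the universal closure of F-0105 is false** (witness: the constant cyclotome
  `μ ≡ ℤ/3ℤ`, the extension `Π = Δ = ℤ/3ℤ ↠ G = 1`, one cusp with `I_x = D_x = Π`, `sx = id`, `sy = inversion`);
* `GalSect.thm_4_3_of_subsingleton` — the degenerate instance form that holds (target `Π_{Y_L}` trivial).

No cone consumer cites an instance of `Thm_4_3` (grep over `Literature/`, `Summits/`: registry line only); the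
model-relative (M)-form needs the model's Galois cyclotome and synchronizations, data beyond `CurveModel`
(`CuspidalizationFactsModel.lean`, "Not here").  HONEST FRAMING: Thm 4.3 is a refereed, undisputed theorem
about cusps of hyperbolic curves over local fields; refuted here is only the closure of the cell's free-data
typing — a statement about the schema, not about the paper.  Nothing here bears on the disputed [IUTchIII]
Cor. 3.12; typed ≠ proved; no side taken.
-/

namespace Literature.AnabelianGeometry.AbsoluteAnabelian.GalSect

universe u

variable {E F : FundamentalExtension.{u}} {T : GaloisCyclotome.{u}}

/-! ### What the predicate pins -/

/-- The identity of `Π` maps every subgroup to itself (bookkeeping for the `I_x ⥲ I_y` hypothesis at `α = id`).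
[cite: MochizukiGalSect2005, Thm 4.3 p.17] -/
private theorem map_refl_toMonoidHom (H : Subgroup E.arith) :
    H.map (ContinuousMulEquiv.refl E.arith).toMonoidHom = H := by
  ext g
  constructor
  · rintro ⟨g', hg', rfl⟩
    exact hg'
  · intro hg
    exact ⟨g, hg, rfl⟩

/-- **The content of `Thm_4_3` in the self-case.**  For two synchronizations `sx`, `sy` of the SAME cusp `x` of the
same data, `Thm_4_3 T sx sy` (applied to `α = id_Π`, `α_G = id_G`, which induce `I_x ⥲ I_x` and, by functoriality
`T.map_refl`, the identity of `μ(G_K)`) forces `sy = sx`: the predicate pins the synchronization.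
[cite: MochizukiGalSect2005, Thm 4.3 p.17] -/
theorem CuspidalSynchronization.natIso_eq_of_thm_4_3 {C : E.CuspidalData} {x : C.Cusp}
    (sx sy : CuspidalSynchronization T E C x) (h : Thm_4_3 T sx sy) : sy.natIso = sx.natIso := by
  refine MulEquiv.ext fun m => Subtype.ext ?_
  have hm := h (ContinuousMulEquiv.refl _) (ContinuousMulEquiv.refl _) (fun _ => rfl)
    (map_refl_toMonoidHom (C.Icusp x)) m
  rw [T.map_refl] at hm
  exact hm.symm

/-- **F-0105 is a schema**: twisting a synchronization `sx` by the inversion `m ↦ m⁻¹` of the (commutative)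
cyclotome gives data `(sx, sx ∘ inv)` VIOLATING `Thm_4_3`, as soon as `μ(G_K)` has an element with `m ≠ m⁻¹`.
[cite: MochizukiGalSect2005, Thm 4.3 p.17] -/
theorem not_thm_4_3_inv_twist {C : E.CuspidalData} {x : C.Cusp} (sx : CuspidalSynchronization T E C x)
    (m : T.μ E.gal) (hm : m ≠ m⁻¹) :
    ¬ Thm_4_3 T sx (⟨(MulEquiv.inv (T.μ E.gal)).trans sx.natIso⟩ : CuspidalSynchronization T E C x) := by
  intro h
  have he := CuspidalSynchronization.natIso_eq_of_thm_4_3 sx _ h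
  have hmm : sx.natIso m⁻¹ = sx.natIso m := MulEquiv.congr_fun he m
  exact hm (sx.natIso.injective hmm).symm

/-! ### The universal closure of F-0105 is false -/

/-- **The universal closure of F-0105 is false** (universe `0`).  Witness: the CONSTANT cyclotome interface
`μ(G) := ℤ/3ℤ` (all transports the identity — functorial), the extension `Π = Δ = ℤ/3ℤ ↠ G = 1` (finite discrete,
trivial augmentation), ONE cusp with `D_x = I_x = Π` (closed; `I_x = D_x ∩ Δ`), `sx = id : ℤ/3 ⥲ I_x` and
`sy := sx ∘ inv`; at `α = id` the square fails at the generator (`1 ≠ −1 mod 3`).  Thm 4.3 itself (natural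
synchronizations at rational cusps of hyperbolic curves over local fields) is not touched.
[cite: MochizukiGalSect2005, Thm 4.3 p.17] -/
theorem not_forall_thm_4_3 :
    ¬ ∀ (E F : FundamentalExtension.{0}) (T : GaloisCyclotome.{0}) (Cx : E.CuspidalData) (Cy : F.CuspidalData)
        (x : Cx.Cusp) (y : Cy.Cusp) (sx : CuspidalSynchronization T E Cx x)
        (sy : CuspidalSynchronization T F Cy y), Thm_4_3 T sx sy := by
  intro H
  -- the constant cyclotome `ℤ/3ℤ`
  let T : GaloisCyclotome.{0} :=
    { μ := fun _ => Multiplicative (ZMod 3)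
      map := fun _ => MulEquiv.refl _
      map_refl := fun _ => rfl
      map_trans := fun _ _ => rfl }
  -- the extension `Π = Δ = ℤ/3ℤ ↠ G = 1`
  let P : ProfiniteGrp.{0} := ProfiniteGrp.of (Multiplicative (ZMod 3))
  let G : ProfiniteGrp.{0} := ProfiniteGrp.of PUnit.{1}
  let E : FundamentalExtension.{0} :=
    { arith := P, gal := G, aug := 1, aug_surjective := fun u => ⟨1, Subsingleton.elim _ _⟩ }
  have hgeom : E.geom = ⊤ :=
    eq_top_iff.mpr fun g _ => E.mem_geom.mpr (Subsingleton.elim _ _)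
  -- one cusp with `D_x = I_x = Π`
  let C : E.CuspidalData :=
    { Cusp := PUnit
      Dcusp := fun _ => ⊤
      Icusp := fun _ => ⊤
      Icusp_eq := fun _ => by rw [top_inf_eq, hgeom]
      isClosed_Dcusp := fun _ => by
        rw [Subgroup.coe_top]
        exact isClosed_univ
      eq_of_conj := fun _ _ _ _ => rfl }
  -- the identity synchronization `ℤ/3 ⥲ I_x = Π`
  let sx : CuspidalSynchronization T E C PUnit.unit :=
    ⟨(Subgroup.topEquiv : (⊤ : Subgroup E.arith) ≃* E.arith).symm⟩
  refine not_thm_4_3_inv_twist sx (Multiplicative.ofAdd (1 : ZMod 3)) ?_ (H E E T C C _ _ sx _)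
  change Multiplicative.ofAdd (1 : ZMod 3) ≠ Multiplicative.ofAdd (-1)
  exact Multiplicative.ofAdd.injective.ne (by decide : (1 : ZMod 3) ≠ -1)

/-! ### An instance form that holds -/

/-- Degenerate instance: if `Π_{Y_L}` is trivial, every square of elements of `Π_{Y_L}` commutes, so
`Thm_4_3 T sx sy` holds for all synchronization data. [cite: MochizukiGalSect2005, Thm 4.3 p.17] -/
theorem thm_4_3_of_subsingleton [Subsingleton F.arith] {Cx : E.CuspidalData} {Cy : F.CuspidalData}
    {x : Cx.Cusp} {y : Cy.Cusp} (sx : CuspidalSynchronization T E Cx x)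
    (sy : CuspidalSynchronization T F Cy y) : Thm_4_3 T sx sy :=
  fun _ _ _ _ _ => Subsingleton.elim _ _

end Literature.AnabelianGeometry.AbsoluteAnabelian.GalSect
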